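import Literature.AnabelianGeometry.EtaleTheta.Discharge.Sec3Cor38OfTower
import Literature.AnabelianGeometry.EtaleTheta.Discharge.Sec3Thm37OfRankOneObjectR
import Literature.AnabelianGeometry.EtaleTheta.Discharge.Sec3Prop34CnstOfGaloisCovering
import Literature.AnabelianGeometry.EtaleTheta.TemperedFrobenioidOfKummerTwistTower
import Literature.AnabelianGeometry.EtaleTheta.TemperedFrobenioidOfKummerTateTower
import Literature.AnabelianGeometry.EtaleTheta.TemperedFrobenioidOfGaloisCoveringTateTower
import Literature.AnabelianGeometry.EtaleTheta.LogDivisorModelTateTowerConstantField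
import HarnessLib

/-!
# [EtTh] Theorem 3.7 (iii) — NODE CLOSER AT THE TOWER MODELS OF RECORD: `D^cnst` as an honest SLOT over any v2 tower
# (hence over the ζ-twisted Kummer tower), CLOSED OUTRIGHT at the v1 Tate tower and the v2 Kummer–Tate tower

S. Mochizuki, *The étale theta function and its Frobenioid-theoretic manifestations*, Publ. RIMS **45** (2009) [EtTh], §3,
Theorem 3.7 (iii), PDF p. 79 l. 37 – p. 80 l. 6, proof p. 80 l. 22 ("Assertion (iii) follows immediately from Proposition 3.4,
(ii)") of `paper:doi-10-2977-prims-1234361159` [cite: MochizukiEtTh2009, Thm 3.7 (iii) p.79]; Prop. 3.4 (ii) p. 74; the functor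
`D₀ → D^cnst = B(Spec K)⁰` p. 72.

Proof-only companion (theorems only: no `def`, no `Prop` fact, no instance; abc-iut cell, layer L2, cone node **`EtTh:Thm3.7(iii)`**,
seat abc-iut-w6-d039), sequel of `Sec3Thm37iiiNode.lean` (same seat: the node in print's shape `thm37_iii_node (cnst) (P : Prop34Cnst)`,
binder-free at the connected constructed data keyed on a constant field and at the arithmetic Tate tower).  abc-iut-L2-lead R933
(2026-08-27): «at the ζ-twisted model (iii) needs the NON-CONSTANT `D^cnst` (R914) — take `D^cnst` as an honest `_of_slot` there and
close outright at the TateTower models of record».  This file does exactly that, consuming BY NAME abc-iut-L2-t3's clause closers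
`autActionFactorsThrough_of_prop34Cnst` / `autActionFaithful_of_prop34Cnst` / `thm37_iii_withCnst` (`Sec3Thm37Cnst`, p417345):

* §1 `RealifiedDivisorMonoids.Prop34Cnst.ofRlfZWeak_of_memFΛ` — Prop. 3.4 (ii) relative to `D^cnst` at the weak type-`ℤ` data
  `ofRlfZWeak dm hpf` from its FIRST clause stated at that data (`hP34Λ`: "an element of `B₀^Λ(Y)` with effective image is a
  constant") and the `B₀`-level `D^cnst`-naturality bundle `dm.Prop34Cnst₀ cnst` (clauses 2–4 VERBATIM abc-iut-L2-d2's transport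
  `Prop34Cnst.ofRlfZWeak`, which took clause 1 from `dm.Prop34` instead);
* §2 ANY v2 TOWER `Tw : LogDivisorTower P L` (abc-iut-L2-t3, covering-indexed log-meromorphic functions; Def. 3.3 (iii) data
  `DivisorMonoids.ofTower Tw`): clause 1 is abc-iut-L2-d2's THEOREM `hP34Λ_ofTower_weak` (`Sec3Cor38OfTower`), so
  **`thm37_iii_node_ofTower_of_slot (cnst) (h₀ : (ofTower Tw).Prop34Cnst₀ cnst)`** — the node (both sentences, `Λ = ℤ`) for EVERY
  tempered Frobenioid over `ofRlfZWeak (ofTower Tw) hpf`, `D^cnst` an HONEST SLOT: residual = {the functor `cnst : B^temp(Π)⁰ → D^cnst`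
  and its three `B₀`-level naturality clauses} — nothing about `C`; AS TYPED `thm37_iii_withCnst_ofTower_of_slot`;
* §3 THE ζ-TWISTED KUMMER TOWER (abc-iut-L2-d2, third model of record, `TateTowerKummerTwist.temperedFrobenioidC`, p481604; roots of
  unity MOVED by the Galois group): `TateTowerKummerTwist.thm37_iii_node_temperedFrobenioidC_of_slot (cnst) (h₀)` /
  `thm37_iii_temperedFrobenioidC_of_slot` — the slot form there.  TIGHTNESS (not restated): the slot is NOT fillable by a CONSTANT
  functor — `TateTowerKummerTwist.not_prop34Cnst₀_const` (p483973); print's non-constant `Y ↦ Spec K_Y` there is row «PROP34CNST₀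
  WITH NON-CONSTANT `D^cnst` AT THE TWISTED TOWER» (R914/R936), whose holder feeds `(cnst, h₀)` into these two theorems;
* §4 THE v2 KUMMER–TATE TOWER (abc-iut-L2-d2, `TateTowerKummer.temperedFrobenioid`, p465559; constants `⟨ϖ⟩`, Galois-FIXED, so
  `D^cnst` is honestly one point): CLOSED OUTRIGHT with the constant functor, `h₀ := TateTowerKummer.prop34Cnst₀_ofTower X₀`
  (`Sec3Thm37OfRankOneObjectR`): `TateTowerKummer.thm37_iii_node_temperedFrobenioid` / `thm37_iii_temperedFrobenioid`;
* §5 THE v1 TATE TOWER (abc-iut-w6-d048 / w6-d058, Galois-covering data of `LogDivisorModel.TateTower.action`,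
  `TateTowerFrd.temperedFrobenioid`): CLOSED OUTRIGHT with PRINT's functor `Y ↦ N∖Y` (`cnstFunctor`; here `N = ℤ` — every
  translation fixes the constants, `TateTower.constInertia_eq_top` — so `N∖Y` is a point, honestly): the Galois-correspondence law is
  the THEOREM `TateTower.constGaloisLaw` (`LogDivisorModelTateTowerConstantField`); `TateTowerFrd.thm37_iii_node_temperedFrobenioid` /
  `thm37_iii_temperedFrobenioid`, and `TemperedFrobenioid.thm37_iii_node_tateTower` for EVERY tempered Frobenioid over that data.
The `Λ = ℝ` towers of record already carry sentence 1 of (iii) (the only contentful one at `Λ = ℝ`) inside their binder-free Thm. 3.7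
knits — `TateTowerFrd.thm37_temperedFrobenioidR` (`Sec3Thm37TateTowerR`, p453493) and `TateTowerKummer.thm37_temperedFrobenioidR`
(`Sec3Thm37OfRankOneObjectR`) — and are not restated; the arithmetic tower / gaussian datum is §4 of `Sec3Thm37iiiNode`.

HONEST FRAMING: class-(b) design models and instantiation certificates (NOT the tempered Frobenioid of a Tate curve); refereed pre-IUT
material; nothing here bears on [IUTchIII] Cor. 3.12; no side taken; no statement of the paper is strengthened; typed ≠ proved — here
proved, modulo the literal slot where stated.
-/

noncomputable section

namespace Literature.AnabelianGeometry.EtaleTheta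

open CategoryTheory Opposite Literature.AlgebraicGeometry.Frobenioids Literature.AnabelianGeometry.SemiGraphs

universe u₀ v₀ u₁ v₁ u v w

/-! ### §1 `Prop34Cnst` at the weak type-`ℤ` data from clause 1 AT THAT DATA and the `B₀`-level naturality bundle -/

namespace RealifiedDivisorMonoids.Prop34Cnst

variable {D₀ : Type u} [Category.{v} D₀] {dm : DivisorMonoids.{u, v, w} D₀}
  {hpf : ∀ Y : D₀ᵒᵖ, IsPerfFactorialCof (dm.Φ₀.obj Y)} {Dcnst : Type u₁} [Category.{v₁} Dcnst] {cnst : D₀ ⥤ Dcnst}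

/-- **Prop. 3.4 (ii) relative to `D^cnst` for `T = ofRlfZWeak dm hpf`** from clause 1 stated at `T` itself (`hP34Λ`: an element of
`B₀^Λ(Y)` whose image in `(Φ₀^ℝ)^gp(Y)` is effective is a constant — a THEOREM at every v2 tower, `hP34Λ_ofTower_weak`) and the
`B₀`-level bundle `dm.Prop34Cnst₀ cnst`; clauses 2–4 verbatim abc-iut-L2-d2's `Prop34Cnst.ofRlfZWeak`.
[cite: MochizukiEtTh2009, Prop 3.4 (ii) p.74] -/
theorem ofRlfZWeak_of_memFΛ
    (hP34Λ : ∀ (Y : D₀ᵒᵖ) (b : (RealifiedDivisorMonoids.ofRlfZWeak dm hpf).BΛ.obj Y)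
      (x : (RealifiedDivisorMonoids.ofRlfZWeak dm hpf).ΦR.obj Y),
      (RealifiedDivisorMonoids.ofRlfZWeak dm hpf).divΛ Y b = Algebra.GrothendieckGroup.of x →
        b ∈ (RealifiedDivisorMonoids.ofRlfZWeak dm hpf).FΛ Y)
    (h₀ : dm.Prop34Cnst₀ cnst) : (RealifiedDivisorMonoids.ofRlfZWeak dm hpf).Prop34Cnst cnst where
  mem_FΛ_of_divΛ_eq_of := hP34Λ
  BΛ_map_eq_of_cnst_map_eq g g' hg b hb := h₀.B₀_map_eq_of_cnst_map_eq g g' hg b hb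
  ΦR_map_eq_of_cnst_map_eq := by
    rintro Y Y' g g' hg x ⟨b, hb, hbx⟩
    obtain ⟨x₀, hx₀, rfl⟩ := RlfEffective.exists_eq_of_weak (hpf (op Y')).weak (dm.div₀ (op Y') b) x hbx
    change rlfMapWeak dm.Φ₀ hpf g.op ((hpf (op Y')).weak.toRealification (Perfection.of _ x₀)) =
      rlfMapWeak dm.Φ₀ hpf g'.op ((hpf (op Y')).weak.toRealification (Perfection.of _ x₀))
    rw [rlfMapWeak_toRealification_of, rlfMapWeak_toRealification_of,
      h₀.Φ₀_map_eq_of_cnst_map_eq g g' hg x₀ ⟨b, hb, hx₀⟩]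
  cnst_map_eq_of_BΛ_map_eq _ Y g g' hker := by
    refine h₀.cnst_map_eq_of_B₀_map_eq g g' fun b hb => hker b ?_
    change gpMap (((toRlfNatTransWeak dm.Φ₀ hpf).app (op Y)).hom) (dm.div₀ (op Y) b) = 1
    rw [hb, map_one]

end RealifiedDivisorMonoids.Prop34Cnst

/-! ### §2 Any v2 tower: `D^cnst` as an honest slot -/

namespace TemperedFrobenioid

section Tower

variable {P : Type u} [Group P] [TopologicalSpace P] {L : LevelSystem P} (Tw : LogDivisorTower P L)
  (hpf : ∀ Y : (ConnectedPart (BTemp P))ᵒᵖ, IsPerfFactorialCof ((DivisorMonoids.ofTower Tw).Φ₀.obj Y))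
  {D : Type u₀} [Category.{v₀} D] {VD : FrdICatStub.{u₀, v₀, u} D}
  (C₀ : TemperedFrobenioid (RealifiedDivisorMonoids.ofRlfZWeak (DivisorMonoids.ofTower Tw) hpf) D VD)
  {Dcnst : Type u₁} [Category.{v₁} Dcnst]

/-- **Prop. 3.4 (ii) relative to `D^cnst` at the type-`ℤ` data of ANY v2 tower, `D^cnst` a slot**: clause 1 is the theorem
`hP34Λ_ofTower_weak` (per level abc-iut-w6-d058's `mem_fZero_of_divZeroHom_eq_of`), so only the functor `cnst : B^temp(Π)⁰ → D^cnst`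
with its `B₀`-level naturality clauses `h₀` remains. [cite: MochizukiEtTh2009, Prop 3.4 (ii) p.74] -/
theorem prop34Cnst_ofTower_of_slot (cnst : ConnectedPart (BTemp P) ⥤ Dcnst)
    (h₀ : (DivisorMonoids.ofTower Tw).Prop34Cnst₀ cnst) :
    (RealifiedDivisorMonoids.ofRlfZWeak (DivisorMonoids.ofTower Tw) hpf).Prop34Cnst cnst :=
  RealifiedDivisorMonoids.Prop34Cnst.ofRlfZWeak_of_memFΛ (TemperedFrobenioid.hP34Λ_ofTower_weak Tw hpf) h₀

/-- **[EtTh] Thm 3.7 (iii) — the node at ANY v2 tower with `D^cnst` as an honest SLOT** (abc-iut-L2-lead R933): for EVERY tempered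
Frobenioid `C₀` (any base category, any vocabulary) over the type-`ℤ` Def. 3.6 (i) data `ofRlfZWeak (ofTower Tw) hpf` of a tower
`Tw`, and every functor `cnst : B^temp(Π)⁰ → D^cnst` satisfying the three `B₀`-level naturality clauses of Prop. 3.4 (ii) (`h₀`):
(sentence 1) for every `A`, automorphisms of `A` with the same image in `Aut_{D^cnst}(A^cnst)` conjugate `O^▷(A)`, `O^×(A)` identically,
AND (sentence 2, `Λ = ℤ`) automorphisms conjugating `O^×(A)` identically have the same image there.  Residual = the slot `(cnst, h₀)`
only. [cite: MochizukiEtTh2009, Thm 3.7 (iii) p.79] -/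
theorem thm37_iii_node_ofTower_of_slot (cnst : ConnectedPart (BTemp P) ⥤ Dcnst)
    (h₀ : (DivisorMonoids.ofTower Tw).Prop34Cnst₀ cnst) :
    (∀ X : C₀.category, FrobenioidFacade.AutActionFactorsThrough (C₀.base ⋙ cnst) C₀.toElem X) ∧
      ∀ X : C₀.category, FrobenioidFacade.AutActionFaithful (C₀.base ⋙ cnst) C₀.toElem X :=
  ⟨fun X => C₀.autActionFactorsThrough_of_prop34Cnst (prop34Cnst_ofTower_of_slot Tw hpf cnst h₀) X,
    fun X => C₀.autActionFaithful_of_prop34Cnst (prop34Cnst_ofTower_of_slot Tw hpf cnst h₀) (Or.inl rfl) X⟩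

/-- **AS TYPED at any v2 tower, `D^cnst` a slot**: abc-iut-L2-t3's `Thm37_iii` at the facade instantiated with `(D → B^temp(Π)⁰) ⋙ cnst`
(any facade `F` for the [FrdI] fields), residual = `(cnst, h₀)`. [cite: MochizukiEtTh2009, Thm 3.7 (iii) p.79] -/
theorem thm37_iii_withCnst_ofTower_of_slot (F : FrobenioidFacade.{u₀, v₀, u} D) (cnst : ConnectedPart (BTemp P) ⥤ Dcnst)
    (h₀ : (DivisorMonoids.ofTower Tw).Prop34Cnst₀ cnst) :
    C₀.Thm37_iii (F.withCnst (C₀.base ⋙ cnst)) :=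
  C₀.thm37_iii_withCnst F (prop34Cnst_ofTower_of_slot Tw hpf cnst h₀)

end Tower

end TemperedFrobenioid

/-! ### §3 The ζ-twisted Kummer tower: the slot form (the constant functor being refuted there) -/

namespace TateTowerKummerTwist

variable (R S : ((Discrete PUnit.{1})ᵒᵖ ⥤ CommMonCat.{0}) → Prop) {Dcnst : Type u₁} [Category.{v₁} Dcnst]

/-- **[EtTh] Thm 3.7 (iii) at THE tempered Frobenioid of the ζ-TWISTED Kummer tower, `D^cnst` an honest SLOT** (abc-iut-L2-lead
R933/R914): for every functor `cnst : B^temp(Compat)⁰ → D^cnst` with the `B₀`-level naturality clauses `h₀` over abc-iut-L2-d2's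
`ofTower towerC`, both sentences hold for `temperedFrobenioidC` (`Λ = ℤ`).  The slot is NOT fillable by a constant functor
(`not_prop34Cnst₀_const`, p483973: the Galois group MOVES the roots of unity among the constants); print's `Y ↦ Spec K_Y` there is the
successor row's datum. [cite: MochizukiEtTh2009, Thm 3.7 (iii) p.79] -/
theorem thm37_iii_node_temperedFrobenioidC_of_slot (cnst : ConnectedPart (BTemp Compat) ⥤ Dcnst)
    (h₀ : (DivisorMonoids.ofTower towerC).Prop34Cnst₀ cnst) :
    (∀ X : (temperedFrobenioidC R S).category, FrobenioidFacade.AutActionFactorsThrough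
        ((temperedFrobenioidC R S).base ⋙ cnst) (temperedFrobenioidC R S).toElem X) ∧
      ∀ X : (temperedFrobenioidC R S).category, FrobenioidFacade.AutActionFaithful
        ((temperedFrobenioidC R S).base ⋙ cnst) (temperedFrobenioidC R S).toElem X :=
  (temperedFrobenioidC R S).thm37_iii_node_ofTower_of_slot towerC hpfC cnst h₀

/-- **AS TYPED at the ζ-twisted tower, `D^cnst` a slot**: `Thm37_iii (temperedFrobenioidC R S) (F.withCnst (base ⋙ cnst))` for every
facade `F`, residual `(cnst, h₀)`. [cite: MochizukiEtTh2009, Thm 3.7 (iii) p.79] -/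
theorem thm37_iii_temperedFrobenioidC_of_slot (F : FrobenioidFacade.{0, 0, 0} (Discrete PUnit.{1}))
    (cnst : ConnectedPart (BTemp Compat) ⥤ Dcnst) (h₀ : (DivisorMonoids.ofTower towerC).Prop34Cnst₀ cnst) :
    (temperedFrobenioidC R S).Thm37_iii (F.withCnst ((temperedFrobenioidC R S).base ⋙ cnst)) :=
  (temperedFrobenioidC R S).thm37_iii_withCnst_ofTower_of_slot towerC hpfC F cnst h₀

end TateTowerKummerTwist

/-! ### §4 The v2 Kummer–Tate tower: closed outright (constants Galois-fixed, `D^cnst` honestly a point) -/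

namespace TateTowerKummer

variable (R S : ((Discrete PUnit.{1})ᵒᵖ ⥤ CommMonCat.{0}) → Prop) {Dc : Type u₁} [Category.{v₁} Dc] (X₀ : Dc)

/-- **[EtTh] Thm 3.7 (iii) at THE tempered Frobenioid of the v2 Kummer–Tate tower, NO binder**: the constants `⟨ϖ⟩` of every level are
FIXED by the Galois group, so every constant functor to a point `X₀` of any `D^cnst` satisfies the `B₀`-level clauses
(`prop34Cnst₀_ofTower X₀`, abc-iut-L2-d2) and both sentences hold for `temperedFrobenioid R S` — sentence 1 reading «`Aut_C(A)` acts
trivially on `O^▷(A)`, `O^×(A)`», sentence 2 trivially. [cite: MochizukiEtTh2009, Thm 3.7 (iii) p.79] -/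
theorem thm37_iii_node_temperedFrobenioid :
    (∀ X : (temperedFrobenioid R S).category, FrobenioidFacade.AutActionFactorsThrough
        ((temperedFrobenioid R S).base ⋙ (Functor.const (ConnectedPart (BTemp Grp))).obj X₀) (temperedFrobenioid R S).toElem X) ∧
      ∀ X : (temperedFrobenioid R S).category, FrobenioidFacade.AutActionFaithful
        ((temperedFrobenioid R S).base ⋙ (Functor.const (ConnectedPart (BTemp Grp))).obj X₀) (temperedFrobenioid R S).toElem X :=
  (temperedFrobenioid R S).thm37_iii_node_ofTower_of_slot tower hpf _ (prop34Cnst₀_ofTower X₀)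

/-- **AS TYPED at the v2 Kummer–Tate tower, closed term** (any facade `F`, any point `X₀` of any `D^cnst`).
[cite: MochizukiEtTh2009, Thm 3.7 (iii) p.79] -/
theorem thm37_iii_temperedFrobenioid (F : FrobenioidFacade.{0, 0, 0} (Discrete PUnit.{1})) :
    (temperedFrobenioid R S).Thm37_iii
      (F.withCnst ((temperedFrobenioid R S).base ⋙ (Functor.const (ConnectedPart (BTemp Grp))).obj X₀)) :=
  (temperedFrobenioid R S).thm37_iii_withCnst_ofTower_of_slot tower hpf F _ (prop34Cnst₀_ofTower X₀)

end TateTowerKummer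

/-! ### §5 The v1 Tate tower (Galois-covering data): closed outright with print's `Y ↦ N∖Y` -/

namespace TemperedFrobenioid

section TateTower

open LogDivisorModel LogDivisorModel.GaloisAction

variable {hpf : ∀ Y : ((isConnectedGSet (G := Multiplicative ℤ)).FullSubcategory)ᵒᵖ,
    IsPerfFactorialCof ((DivisorMonoids.ofGaloisActionConnected TateTower.action TateTower.cuspLaws).Φ₀.obj Y)}
  {D : Type u₀} [Category.{v₀} D] {VD : FrdICatStub.{u₀, v₀, 0} D}
  (C₀ : TemperedFrobenioid
    (RealifiedDivisorMonoids.ofRlfZWeak (DivisorMonoids.ofGaloisActionConnected TateTower.action TateTower.cuspLaws) hpf) D VD)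

/-- **[EtTh] Thm 3.7 (iii) for EVERY tempered Frobenioid over the v1 Tate tower's connected Galois-covering data, NO binder**, with
print's constant-field functor `Y ↦ N∖Y` (`TateTower.action.cnstFunctor`; `N = ℤ` = the whole Galois group of the combinatorial tower,
`TateTower.constInertia_eq_top`, so `N∖Y` is one point): Prop. 3.4 (ii) is abc-iut-w5-d179's `prop34_ofGaloisActionConnected`, its
`D^cnst` clauses abc-iut-w6-d058's `prop34Cnst₀_ofGaloisActionConnected` at the THEOREM `TateTower.constGaloisLaw`.
[cite: MochizukiEtTh2009, Thm 3.7 (iii) p.79] -/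
theorem thm37_iii_node_tateTower :
    (∀ X : C₀.category, FrobenioidFacade.AutActionFactorsThrough (C₀.base ⋙ TateTower.action.cnstFunctor) C₀.toElem X) ∧
      ∀ X : C₀.category, FrobenioidFacade.AutActionFaithful (C₀.base ⋙ TateTower.action.cnstFunctor) C₀.toElem X :=
  have P := RealifiedDivisorMonoids.Prop34Cnst.ofRlfZWeak (hpf := hpf)
    (DivisorMonoids.prop34_ofGaloisActionConnected TateTower.action TateTower.cuspLaws (fun _ => True) fun _ => True)
    (DivisorMonoids.prop34Cnst₀_ofGaloisActionConnected TateTower.action TateTower.cuspLaws TateTower.constGaloisLaw)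
  ⟨fun X => C₀.autActionFactorsThrough_of_prop34Cnst P X,
    fun X => C₀.autActionFaithful_of_prop34Cnst P (Or.inl rfl) X⟩

end TateTower

end TemperedFrobenioid

namespace TateTowerFrd

open LogDivisorModel LogDivisorModel.GaloisAction

variable (R S : ((Discrete PUnit.{1})ᵒᵖ ⥤ CommMonCat.{0}) → Prop)

/-- **[EtTh] Thm 3.7 (iii) at THE tempered Frobenioid of the v1 Tate tower** (abc-iut-w6-d048 / w6-d058's `TateTowerFrd.temperedFrobenioid`),
print's `Y ↦ N∖Y`, closed term. [cite: MochizukiEtTh2009, Thm 3.7 (iii) p.79] -/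
theorem thm37_iii_node_temperedFrobenioid :
    (∀ X : (temperedFrobenioid R S).category, FrobenioidFacade.AutActionFactorsThrough
        ((temperedFrobenioid R S).base ⋙ TateTower.action.cnstFunctor) (temperedFrobenioid R S).toElem X) ∧
      ∀ X : (temperedFrobenioid R S).category, FrobenioidFacade.AutActionFaithful
        ((temperedFrobenioid R S).base ⋙ TateTower.action.cnstFunctor) (temperedFrobenioid R S).toElem X :=
  (temperedFrobenioid R S).thm37_iii_node_tateTower

/-- **AS TYPED at the v1 Tate tower, closed term** (any facade `F`). [cite: MochizukiEtTh2009, Thm 3.7 (iii) p.79] -/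
theorem thm37_iii_temperedFrobenioid (F : FrobenioidFacade.{0, 0, 0} (Discrete PUnit.{1})) :
    (temperedFrobenioid R S).Thm37_iii (F.withCnst ((temperedFrobenioid R S).base ⋙ TateTower.action.cnstFunctor)) :=
  ⟨fun X => (thm37_iii_node_temperedFrobenioid R S).1 X, fun _ X => (thm37_iii_node_temperedFrobenioid R S).2 X⟩

end TateTowerFrd

end Literature.AnabelianGeometry.EtaleTheta

end
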